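import Summits.ValiantsHypothesis.ValiantsHypothesis.Theorems.MonotoneRestorationOrbitCompressionQPOrbitSupport
import HarnessLib

/-!
# Route MonotoneRestoration — aside `OrbitCompressionQP` (stmt-ValiantsHypothesis-18332): EVEN SUPPORTS
# ARE SUPPORTS IN LOW DEGREE

The orbit-form support theorem (`OrbitSupport.evenSupport_of_orbitSize_lt_choose`, Dixon–Mortimer) gives,
for every gate of a square-symmetric circuit of small orbit size, a set `X` such that every EVEN permutation
fixing `X` pointwise fixes the gate's value.  Upgrading "even" to "all" is, in Dawar–Wilsenach / Dawar–Pago–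
Seppelt, a circuit-structural induction (DW ToCL 2022 Thm 4.10).  For VALUES of low degree it is automatic:

* `fixed_of_evenFixed_of_degree` — if `q ∈ ℂ[x_ij : i, j < n]` is fixed (diagonal action) by every even
  permutation fixing `X` pointwise and `2 · deg q + |X| + 2 ≤ n`, then `q` is fixed by EVERY permutation
  fixing `X` pointwise.  Proof: all transpositions `s` outside `X` give the same `r = s • q`; `d = q - r` is
  negated by each of them; a monomial of `d` involves `≤ 2 deg q` indices, so some transposition outside
  `X` and outside the monomial fixes it, forcing its coefficient to vanish (characteristic `0`); so `d = 0`.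
* `support_eval_of_degree` — hence in a `Sym_n`-symmetric circuit with `ORB(C) < C(n,k)` (`n > 8`,
  `4k ≤ n`) every gate whose value has degree `d` with `2d + k + 1 ≤ n` has a genuine support of size `< k`.

(The anti-invariant `Π_{i<j} (x_ii - x_jj)`, of degree `n(n-1)/2` and diagonal orbit `{±}` of size 2, shows
that some degree hypothesis is necessary for values in general.)  Helper file
(`--supports stmt-ValiantsHypothesis-18332`); def-free; nothing here is a named fact.
-/

noncomputable section

open scoped Classical

-- `Summit.ValiantsHypothesis.ValiantsHypothesis.…` is the tree's single-conjunct layout (Sub = Summit).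
set_option linter.dupNamespace false

namespace Summit.ValiantsHypothesis.ValiantsHypothesis.Theorems

namespace OrbitSupport

open Literature.Computability.AlgebraicComplexity MvPolynomial

/-! ### Monomials involve few indices -/

/-- The indices (rows and columns) occurring in a monomial exponent. [folklore] -/
theorem card_indices_le {n : ℕ} (m : (Fin n × Fin n) →₀ ℕ) :
    (m.support.image Prod.fst ∪ m.support.image Prod.snd).card ≤ 2 * m.sum fun _ e => e := by
  have hsupp : m.support.card ≤ m.sum fun _ e => e := by
    rw [Finsupp.sum, Finset.card_eq_sum_ones]
    exact Finset.sum_le_sum fun x hx => Nat.one_le_iff_ne_zero.2 (Finsupp.mem_support_iff.1 hx)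
  calc (m.support.image Prod.fst ∪ m.support.image Prod.snd).card
      ≤ (m.support.image Prod.fst).card + (m.support.image Prod.snd).card := Finset.card_union_le _ _
    _ ≤ m.support.card + m.support.card := Nat.add_le_add Finset.card_image_le Finset.card_image_le
    _ ≤ 2 * m.sum fun _ e => e := by omega

/-- A permutation fixing all indices of a monomial fixes the monomial. [folklore] -/
theorem mapDomain_eq_self_of_fix {n : ℕ} (m : (Fin n × Fin n) →₀ ℕ) (s : Equiv.Perm (Fin n))
    (hs : ∀ i ∈ m.support.image Prod.fst ∪ m.support.image Prod.snd, s i = i) :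
    m.mapDomain (fun p : Fin n × Fin n => s • p) = m := by
  conv_rhs => rw [← Finsupp.mapDomain_id (v := m)]
  refine Finsupp.mapDomain_congr fun p hp => ?_
  have h1 : s p.1 = p.1 := hs _ (Finset.mem_union_left _ (Finset.mem_image_of_mem _ hp))
  have h2 : s p.2 = p.2 := hs _ (Finset.mem_union_right _ (Finset.mem_image_of_mem _ hp))
  change (s p.1, s p.2) = p
  rw [h1, h2]

/-! ### Even supports are supports in low degree -/

/-- **EVEN SUPPORTS ARE SUPPORTS FOR VALUES OF LOW DEGREE.**  If `q` is fixed, under the diagonal action on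
`x_ij`, by every even permutation fixing `X` pointwise, and `2 · deg q + |X| + 2 ≤ n`, then `q` is fixed by
every permutation fixing `X` pointwise. [folklore] -/
theorem fixed_of_evenFixed_of_degree {n : ℕ} {q : MvPolynomial (Fin n × Fin n) ℂ} {X : Finset (Fin n)}
    (hX : ∀ ρ : Equiv.Perm (Fin n), (∀ x ∈ X, ρ x = x) → Equiv.Perm.sign ρ = 1 → ren ρ q = q)
    (hdeg : 2 * q.totalDegree + X.card + 2 ≤ n) :
    ∀ ρ : Equiv.Perm (Fin n), (∀ x ∈ X, ρ x = x) → ren ρ q = q := by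
  -- two points outside `X`
  have hUcard : 2 ≤ (Finset.univ \ X).card := by
    rw [Finset.card_univ_sdiff, Fintype.card_fin]; omega
  obtain ⟨u, hu, v, hv, huv⟩ := Finset.one_lt_card.1 hUcard
  have huX : u ∉ X := (Finset.mem_sdiff.1 hu).2
  have hvX : v ∉ X := (Finset.mem_sdiff.1 hv).2
  set t : Equiv.Perm (Fin n) := Equiv.swap u v with ht
  have htX : ∀ x ∈ X, t x = x := fun x hx =>
    Equiv.swap_apply_of_ne_of_ne (ne_of_mem_of_not_mem hx huX) (ne_of_mem_of_not_mem hx hvX)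
  have htsign : Equiv.Perm.sign t = -1 := Equiv.Perm.sign_swap huv
  -- every transposition outside `X` acts like `t`
  have hA : ∀ a b : Fin n, a ≠ b → a ∉ X → b ∉ X → ren (Equiv.swap a b) q = ren t q := by
    intro a b hab haX hbX
    have hfix : ren (t * Equiv.swap a b) q = q := by
      refine hX _ (fun x hx => ?_) ?_
      · rw [Equiv.Perm.mul_apply,
          Equiv.swap_apply_of_ne_of_ne (ne_of_mem_of_not_mem hx haX) (ne_of_mem_of_not_mem hx hbX),
          htX x hx]
      · rw [map_mul, htsign, Equiv.Perm.sign_swap hab, Int.units_mul_self]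
    rw [ren_mul] at hfix
    have := congrArg (ren t⁻¹) hfix
    rw [ren_inv_ren] at this
    rw [this, ht, Equiv.swap_inv]
  -- the anti-invariant part vanishes
  set d : MvPolynomial (Fin n × Fin n) ℂ := q - ren t q with hd
  have hB : ∀ a b : Fin n, a ≠ b → a ∉ X → b ∉ X → ren (Equiv.swap a b) d = -d := by
    intro a b hab haX hbX
    rw [hd, map_sub, ← hA a b hab haX hbX, ← ren_mul, Equiv.swap_mul_self, ren_one]
    ring
  have hdeg_d : d.totalDegree ≤ q.totalDegree := by
    refine (totalDegree_sub _ _).trans (max_le le_rfl ?_)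
    exact totalDegree_rename_le _ _
  have hd0 : d = 0 := by
    by_contra hne
    obtain ⟨m, hm⟩ := Finset.nonempty_iff_ne_empty.2 (fun h => hne (support_eq_empty.1 h))
    -- the monomial `m` involves few indices
    set I := m.support.image Prod.fst ∪ m.support.image Prod.snd with hI
    have hIcard : I.card ≤ 2 * q.totalDegree :=
      (card_indices_le m).trans (Nat.mul_le_mul_left 2 ((le_totalDegree hm).trans hdeg_d))
    have hfree : 2 ≤ ((Finset.univ \ X) \ I).card := by
      have h1 : ((Finset.univ \ X) \ I).card ≥ (Finset.univ \ X).card - I.card :=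
        Finset.le_card_sdiff I (Finset.univ \ X)
      rw [Finset.card_univ_sdiff, Fintype.card_fin] at h1
      omega
    obtain ⟨a, ha, b, hb, hab⟩ := Finset.one_lt_card.1 hfree
    have haX : a ∉ X := (Finset.mem_sdiff.1 (Finset.mem_sdiff.1 ha).1).2
    have hbX : b ∉ X := (Finset.mem_sdiff.1 (Finset.mem_sdiff.1 hb).1).2
    have haI : a ∉ I := (Finset.mem_sdiff.1 ha).2
    have hbI : b ∉ I := (Finset.mem_sdiff.1 hb).2
    set s : Equiv.Perm (Fin n) := Equiv.swap a b with hs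
    have hsI : ∀ i ∈ I, s i = i := fun i hi =>
      Equiv.swap_apply_of_ne_of_ne (ne_of_mem_of_not_mem hi haI) (ne_of_mem_of_not_mem hi hbI)
    have hm_fix : m.mapDomain (fun p : Fin n × Fin n => s • p) = m := mapDomain_eq_self_of_fix m s hsI
    have hcoeff : coeff m (ren s d) = coeff m d := by
      conv_lhs => rw [← hm_fix]
      exact coeff_rename_mapDomain _ (MulAction.injective s) d m
    rw [hB a b hab haX hbX, coeff_neg] at hcoeff
    have hzero : coeff m d = 0 := by
      have h2 : (2 : ℂ) * coeff m d = 0 := by linear_combination (-1 : ℂ) * hcoeff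
      simpa using h2
    exact (mem_support_iff.1 hm) hzero
  have hqt : ren t q = q := by
    have := sub_eq_zero.1 (hd ▸ hd0 : q - ren t q = 0)
    exact this.symm
  -- conclusion
  intro ρ hρ
  rcases Int.units_eq_one_or (Equiv.Perm.sign ρ) with hsign | hsign
  · exact hX ρ hρ hsign
  · have hfix : ren (t * ρ) q = q := by
      refine hX _ (fun x hx => by rw [Equiv.Perm.mul_apply, hρ x hx, htX x hx]) ?_
      rw [map_mul, htsign, hsign, Int.units_mul_self]
    rw [ren_mul] at hfix
    have := congrArg (ren t⁻¹) hfix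
    rw [ren_inv_ren] at this
    rw [this, ht, Equiv.swap_inv, ← ht, hqt]

/-- **Gates of low degree have genuine supports.**  In a `Sym_n`-symmetric labelled circuit on the `n × n`
matrix with `ORB(C) < C(n,k)` (`n > 8`, `1 ≤ k`, `4k ≤ n`), every gate whose value has total degree `d`
with `2d + k + 1 ≤ n` has a set `X` of `< k` indices whose pointwise stabiliser fixes its value.
[cite: DawarWilsenach2025, §6; DixonMortimer1996, Thm 5.2B] -/
theorem support_eval_of_degree {n : ℕ} {Y : Type*} {G : Type} [Fintype G]
    [MulAction (Equiv.Perm (Fin n)) Y] (C : LabelledArithCircuit ℂ (Fin n × Fin n) Y G)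
    (hC : C.IsSymmetric (Equiv.Perm (Fin n))) {k : ℕ} (hn : 8 < n) (hk : 1 ≤ k) (h4k : 4 * k ≤ n)
    (horb : C.orbitSize (Equiv.Perm (Fin n)) < n.choose k) (g : G)
    (hdeg : 2 * (C.eval g).totalDegree + k + 1 ≤ n) :
    ∃ X : Finset (Fin n), X.card < k ∧
      ∀ ρ : Equiv.Perm (Fin n), (∀ x ∈ X, ρ x = x) → ren ρ (C.eval g) = C.eval g := by
  obtain ⟨X, hXk, hX⟩ := evenSupport_eval C hC hn hk h4k horb g
  exact ⟨X, hXk, fixed_of_evenFixed_of_degree hX (by omega)⟩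

end OrbitSupport

end Summit.ValiantsHypothesis.ValiantsHypothesis.Theorems

end
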